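import Mathlib.RingTheory.Polynomial.Resultant.Basic
import Mathlib.Analysis.Polynomial.MahlerMeasure
import Mathlib.FieldTheory.IsAlgClosed.Basic
import Mathlib.Analysis.Complex.Polynomial.Basic
import HarnessLib

/-!
# Roy–Waldschmidt 1997, Lemme 3.4: a Wirsing-type estimate for the resultant

First brick of §3 ("Approximations algébriques de nombres transcendants") of D. Roy,
M. Waldschmidt, *Approximation diophantienne et indépendance algébrique de logarithmes*,
Ann. Sci. ÉNS (4) 30 (1997) — the section proving the approximation theorem (Théorème 3.1/3.2)
used in the proof of the paper's Théorème 1.1, of which the tree's named fact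
`Literature.NumberTheory.Transcendental.royWaldschmidt_quadratic_thm_0_2` (Théorème 0.2) is a
corollary (chain Théorème 0.2 ⇐ 0.1 ⇐ Cor. 1.4 ⇐ Cor. 1.3 proved in the sibling files
`QuadraticRelationsLogarithms{Thm01,Cor14,Cor13}.lean`).

**Lemme 3.4** (p. 765; "utilise les idées de Wirsing"). Let `θ ∈ ℂ`, `t ∈ ℝ`, `F, G ∈ ℂ[X]`
non-constant of degrees `m, n`; let `f` (resp. `g`) be the number of roots `α` of `F` (resp. `β`
of `G`) with `|θ - α| ≤ t` (resp. `|θ - β| ≤ t`), with multiplicities, and `ρ` the distance from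
`θ` to the roots of `F` and `G`. Then
`ρ^{fg} |R(F,G)| ≤ 2^{mn} M(F)^{n-g} M(G)^{m-f} |F(θ)|^g |G(θ)|^f`.

We PROVE it in a slightly more flexible form (`RoyWaldschmidt1997.resultant_wirsing`): instead of
a threshold `t`, any sub-multisets `A ≤ roots F`, `B ≤ roots G` of "close" roots are allowed,
provided every close root of one polynomial is at least as close to `θ` as every far root of the
other (which is all the printed proof uses: inequalities (3.4)–(3.6), p. 765–766), and `ρ` is any
non-negative lower bound for the distances.  This form absorbs the two limiting arguments of the
paper (Prop. 3.5 "on peut approcher F et G …", Prop. 3.6 "soit (G_k) une suite …") into a choice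
of `A, B`.  The threshold form is recovered with `A = {α ; |θ - α| ≤ t}`, `B = {β ; |θ - β| ≤ t}`
(`resultant_wirsing_threshold`).  Everything is proved (resultant as a product over the roots:
Mathlib's `Polynomial.resultant_eq_prod_roots_sub`; Mahler measure as leading coefficient times
`∏ max(1, |α|)`: `Polynomial.mahlerMeasure_eq_leadingCoeff_mul_prod_roots`).

## References

* [RoyWaldschmidt1997ENS] D. Roy, M. Waldschmidt, Ann. Sci. ÉNS (4) 30 (1997) 753–796, §3 (ii)
  Lemme 3.4, pp. 765–766 (lit key paper:doi-10-1016-s0012-9593-97-89938-7, PDF pp. 14–15).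
* E. Wirsing, *Approximation mit algebraischen Zahlen beschränkten Grades*, J. reine angew. Math.
  206 (1961) 67–77 (the source of the idea, [34] of the paper; not used here).
-/

noncomputable section

open Polynomial Multiset

namespace Literature.NumberTheory.Transcendental

namespace RoyWaldschmidt1997

/-! ### Products over multisets: elementary inequalities -/

/-- `∏_{x ∈ s} ∏_{y ∈ t} h x y`, as an iterated multiset product. [folklore] -/
theorem prod_map_prod_map_comm {α β : Type*} (s : Multiset α) (t : Multiset β) (h : α → β → ℝ) :
    (s.map fun x => (t.map fun y => h x y).prod).prod =
      (t.map fun y => (s.map fun x => h x y).prod).prod := by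
  induction s using Multiset.induction_on with
  | empty => simp
  | cons a s ih =>
    rw [map_cons, prod_cons, ih, ← prod_map_mul]
    refine congrArg _ (Multiset.map_congr rfl fun y _ => ?_)
    rw [map_cons, prod_cons]

/-- Monotonicity of multiset products of non-negative reals. [folklore] -/
theorem prod_map_le_prod_map' {α : Type*} (s : Multiset α) {f g : α → ℝ} (h0 : ∀ x ∈ s, 0 ≤ f x)
    (h : ∀ x ∈ s, f x ≤ g x) : (s.map f).prod ≤ (s.map g).prod := by
  induction s using Multiset.induction_on with
  | empty => simp
  | cons a s ih =>
    simp only [map_cons, prod_cons]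
    have ha := h a (mem_cons_self a s)
    have ha0 := h0 a (mem_cons_self a s)
    have hs0 : 0 ≤ (s.map f).prod := prod_nonneg fun x hx => by
      obtain ⟨y, hy, rfl⟩ := mem_map.mp hx; exact h0 y (mem_cons_of_mem hy)
    exact mul_le_mul ha (ih (fun x hx => h0 x (mem_cons_of_mem hx))
      (fun x hx => h x (mem_cons_of_mem hx))) hs0 (ha0.trans ha)

/-- A product of factors `≥ 1` is `≥ 1`. [folklore] -/
theorem one_le_prod_map {α : Type*} (s : Multiset α) {f : α → ℝ} (h : ∀ x ∈ s, 1 ≤ f x) :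
    1 ≤ (s.map f).prod := by
  induction s using Multiset.induction_on with
  | empty => simp
  | cons a s ih =>
    simp only [map_cons, prod_cons]
    exact one_le_mul_of_one_le_of_one_le (h a (mem_cons_self a s))
      (ih fun x hx => h x (mem_cons_of_mem hx))

/-- A product of non-negative factors is non-negative. [folklore] -/
theorem prod_map_nonneg {α : Type*} (s : Multiset α) {f : α → ℝ} (h : ∀ x ∈ s, 0 ≤ f x) :
    0 ≤ (s.map f).prod :=
  prod_nonneg fun y hy => by obtain ⟨x, hx, rfl⟩ := mem_map.mp hy; exact h x hx

/-- `∏_{x ∈ s} c = c ^ |s|`. [folklore] -/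
theorem prod_map_const' {α : Type*} (s : Multiset α) (c : ℝ) : (s.map fun _ => c).prod = c ^ card s := by
  simp

/-! ### Norms of products -/

/-- `‖∏‖ = ∏ ‖·‖` over a multiset of complex numbers. [folklore] -/
theorem norm_multiset_prod (s : Multiset ℂ) : ‖s.prod‖ = (s.map fun z => ‖z‖).prod := by
  have := map_multiset_prod (normHom : ℂ →*₀ ℝ) s
  simpa using this

/-! ### The factorisations over the roots -/

variable (F : ℂ[X]) (θ : ℂ)

/-- Over `ℂ`, `|roots F| = deg F`. [folklore] -/
theorem card_roots_eq : card F.roots = F.natDegree :=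
  (IsAlgClosed.splits F).natDegree_eq_card_roots.symm

/-- `|F(θ)| = |a₀| ∏_{α} |θ - α|` over the roots `α` of `F` (with multiplicity). [folklore] -/
theorem norm_eval_eq_prod_roots :
    ‖F.eval θ‖ = ‖F.leadingCoeff‖ * (F.roots.map fun α => ‖θ - α‖).prod := by
  conv_lhs => rw [← C_leadingCoeff_mul_prod_multiset_X_sub_C (card_roots_eq F)]
  rw [eval_mul, eval_C, eval_multiset_prod, norm_mul, norm_multiset_prod, Multiset.map_map,
    Multiset.map_map]
  congr 2
  refine Multiset.map_congr rfl fun α _ => ?_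
  simp

/-! ### Lemme 3.4 -/

/-- **Roy–Waldschmidt 1997, Lemme 3.4 (Wirsing-type resultant estimate), flexible form.**
Let `F, G ∈ ℂ[X]` be non-zero of degrees `m, n`, `θ ∈ ℂ`, `A ≤ roots F`, `B ≤ roots G`
sub-multisets ("close roots") with `|θ - α| ≤ |θ - β|` whenever `α ∈ A`, `β ∉ B` or `α ∉ A`,
`β ∈ B` (reversed), and `0 ≤ ρ ≤ |θ - γ|` for all roots `γ` of `F` and `G`.  Then, with
`f = |A|`, `g = |B|`,
`ρ^{fg} |Res(F,G)| ≤ 2^{mn} M(F)^{n-g} M(G)^{m-f} |F(θ)|^g |G(θ)|^f`.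
Proof as printed ((3.4)–(3.6), p. 765–766): split `∏ |α - β|` into the four blocks
`A × B`, `A × Bᶜ`, `Aᶜ × B`, `Aᶜ × Bᶜ` and bound `|α - β|` respectively by `(2p_α)(2q_β)/(2ρ)`,
`2q_β`, `2p_α`, `2 max(1,|α|) max(1,|β|)`. [cite: RoyWaldschmidt1997ENS, §3 (ii) Lemme 3.4, pp. 765–766] -/
theorem resultant_wirsing (F G : ℂ[X]) (hF : F ≠ 0) (hG : G ≠ 0) (θ : ℂ)
    (A B : Multiset ℂ) (hA : A ≤ F.roots) (hB : B ≤ G.roots) (ρ : ℝ) (hρ : 0 ≤ ρ)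
    (hρF : ∀ α ∈ F.roots, ρ ≤ ‖θ - α‖) (hρG : ∀ β ∈ G.roots, ρ ≤ ‖θ - β‖)
    (hAB : ∀ α ∈ A, ∀ β ∈ G.roots - B, ‖θ - α‖ ≤ ‖θ - β‖)
    (hBA : ∀ β ∈ B, ∀ α ∈ F.roots - A, ‖θ - β‖ ≤ ‖θ - α‖) :
    ρ ^ (card A * card B) * ‖resultant F G‖ ≤
      2 ^ (F.natDegree * G.natDegree) * F.mahlerMeasure ^ (G.natDegree - card B) *
        G.mahlerMeasure ^ (F.natDegree - card A) *
        ‖F.eval θ‖ ^ card B * ‖G.eval θ‖ ^ card A := by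
  -- notation
  set S := F.roots with hS
  set T := G.roots with hT
  set m := F.natDegree with hm
  set n := G.natDegree with hn
  set a := F.leadingCoeff with ha
  set b := G.leadingCoeff with hb
  set f := card A with hf
  set g := card B with hg
  have hSm : card S = m := card_roots_eq F
  have hTn : card T = n := card_roots_eq G
  have ha0 : a ≠ 0 := leadingCoeff_ne_zero.mpr hF
  have hb0 : b ≠ 0 := leadingCoeff_ne_zero.mpr hG
  obtain ⟨A', hSA⟩ := Multiset.le_iff_exists_add.mp hA
  obtain ⟨B', hTB⟩ := Multiset.le_iff_exists_add.mp hB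
  have hA' : S - A = A' := by rw [hSA, add_tsub_cancel_left]
  have hB' : T - B = B' := by rw [hTB, add_tsub_cancel_left]
  rw [hA'] at hBA
  rw [hB'] at hAB
  have hfm : f ≤ m := by rw [← hSm, hSA, card_add]; exact Nat.le_add_right _ _
  have hgn : g ≤ n := by rw [← hTn, hTB, card_add]; exact Nat.le_add_right _ _
  have hcA' : card A' = m - f := by
    have := congrArg card hSA; rw [card_add, hSm] at this; omega
  have hcB' : card B' = n - g := by
    have := congrArg card hTB; rw [card_add, hTn] at this; omega
  -- distances
  let p : ℂ → ℝ := fun α => ‖θ - α‖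
  have hp0 : ∀ z, 0 ≤ p z := fun z => norm_nonneg _
  -- the resultant as a product over the roots
  let F₁ : ℂ[X] := (S.map fun α => X - C α).prod
  let G₁ : ℂ[X] := (T.map fun β => X - C β).prod
  have hF₁ : F = C a * F₁ := (C_leadingCoeff_mul_prod_multiset_X_sub_C hSm).symm
  have hG₁ : G = C b * G₁ := (C_leadingCoeff_mul_prod_multiset_X_sub_C hTn).symm
  have hF₁m : F₁.Monic := monic_multiset_prod_of_monic _ _ fun α _ => monic_X_sub_C α
  have hG₁m : G₁.Monic := monic_multiset_prod_of_monic _ _ fun β _ => monic_X_sub_C β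
  have hF₁r : F₁.roots = S := roots_multiset_prod_X_sub_C S
  have hG₁r : G₁.roots = T := roots_multiset_prod_X_sub_C T
  have hF₁d : F₁.natDegree = m := by
    rw [natDegree_multiset_prod_X_sub_C_eq_card, hSm]
  have hG₁d : G₁.natDegree = n := by
    rw [natDegree_multiset_prod_X_sub_C_eq_card, hTn]
  have hres : resultant F G m n = a ^ n * b ^ m * ((S ×ˢ T).map fun ij => ij.1 - ij.2).prod := by
    rw [hF₁, hG₁, resultant_C_mul_left, resultant_C_mul_right, ← mul_assoc, ← hF₁d, ← hG₁d,
      resultant_eq_prod_roots_sub F₁ G₁ hF₁m hG₁m (IsAlgClosed.splits _) (IsAlgClosed.splits _),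
      hF₁r, hG₁r]
  -- the double product of the `|α - β|`
  let P : Multiset ℂ → Multiset ℂ → ℝ := fun U V =>
    (U.map fun α => (V.map fun β => ‖α - β‖).prod).prod
  have hPdef : ∀ U V, P U V = (U.map fun α => (V.map fun β => ‖α - β‖).prod).prod := fun U V => rfl
  have hP0 : ∀ U V, 0 ≤ P U V := fun U V =>
    prod_nonneg fun x hx => by
      obtain ⟨α, -, rfl⟩ := mem_map.mp hx
      exact prod_nonneg fun y hy => by obtain ⟨β, -, rfl⟩ := mem_map.mp hy; exact norm_nonneg _
  have hnormres : ‖resultant F G m n‖ = ‖a‖ ^ n * ‖b‖ ^ m * P S T := by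
    rw [hres, norm_mul, norm_mul, norm_pow, norm_pow, norm_multiset_prod, Multiset.map_map]
    congr 1
    -- `∏_{S × T} = ∏_S ∏_T`
    simp only [hPdef, Function.comp_def]
    rw [show (S ×ˢ T) = S.bind (fun a => T.map (Prod.mk a)) from rfl, Multiset.map_bind,
      Multiset.prod_bind]
    simp [Multiset.map_map]
  -- splitting the double product into four blocks
  have hPsplit : P S T = P A B * P A B' * (P A' B * P A' B') := by
    have h1 : ∀ U, P U T = P U B * P U B' := fun U => by
      simp only [hPdef, hTB, Multiset.map_add, Multiset.prod_add, prod_map_mul]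
    rw [show P S T = P A T * P A' T by simp only [hPdef, hSA, Multiset.map_add, Multiset.prod_add],
      h1 A, h1 A']
  -- block bounds
  -- (3.5): on `A × B`, `(2ρ) |α - β| ≤ (2 p_α)(2 q_β)`
  have hb1 : (2 * ρ) ^ (f * g) * P A B ≤
      (A.map fun α => 2 * p α).prod ^ g * (B.map fun β => 2 * p β).prod ^ f := by
    have key : ∀ α ∈ A, ∀ β ∈ B, (2 * ρ) * ‖α - β‖ ≤ (2 * p α) * (2 * p β) := by
      intro α hα β hβ
      have hρα : ρ ≤ p α := hρF α (Multiset.mem_of_le hA hα)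
      have hρβ : ρ ≤ p β := hρG β (Multiset.mem_of_le hB hβ)
      have htri : ‖α - β‖ ≤ p α + p β := by
        calc ‖α - β‖ = ‖(θ - β) - (θ - α)‖ := by ring_nf
          _ ≤ ‖θ - β‖ + ‖θ - α‖ := norm_sub_le _ _
          _ = p α + p β := add_comm _ _
      rcases le_total (p α) (p β) with h | h
      · calc 2 * ρ * ‖α - β‖ ≤ 2 * p α * (p α + p β) :=
            mul_le_mul (by linarith) htri (norm_nonneg _) (by linarith [hp0 α])
          _ ≤ 2 * p α * (2 * p β) := mul_le_mul_of_nonneg_left (by linarith) (by linarith [hp0 α])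
      · calc 2 * ρ * ‖α - β‖ ≤ 2 * p β * (p α + p β) :=
            mul_le_mul (by linarith) htri (norm_nonneg _) (by linarith [hp0 β])
          _ ≤ 2 * p β * (2 * p α) := mul_le_mul_of_nonneg_left (by linarith) (by linarith [hp0 β])
          _ = 2 * p α * (2 * p β) := by ring
    -- multiply over `A × B`
    have step : ∀ (U : Multiset ℂ), (∀ α ∈ U, α ∈ A) →
        (2 * ρ) ^ (card U * g) * P U B ≤
          (U.map fun α => 2 * p α).prod ^ g * (B.map fun β => 2 * p β).prod ^ card U := by
      intro U hU
      induction U using Multiset.induction_on with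
      | empty => simp [hPdef]
      | cons α U ih =>
        have hαA : α ∈ A := hU α (mem_cons_self α U)
        have ih' := ih fun x hx => hU x (mem_cons_of_mem hx)
        simp only [hPdef, map_cons, prod_cons, card_cons] at ih' ⊢
        -- row of `α`: `(2ρ)^g ∏_B |α - β| ≤ (2 p_α)^g ∏_B (2 q_β)`
        have hrow : (2 * ρ) ^ g * (B.map fun β => ‖α - β‖).prod ≤
            (2 * p α) ^ g * (B.map fun β => 2 * p β).prod := by
          have eL : (B.map fun β => (2 * ρ) * ‖α - β‖).prod = (2 * ρ) ^ g * (B.map fun β => ‖α - β‖).prod := by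
            conv_lhs => rw [prod_map_mul, prod_map_const']
          have eR : (B.map fun β => (2 * p α) * (2 * p β)).prod =
              (2 * p α) ^ g * (B.map fun β => 2 * p β).prod := by
            conv_lhs => rw [prod_map_mul, prod_map_const']
          rw [← eL, ← eR]
          exact prod_map_le_prod_map' B (fun β _ => mul_nonneg (by linarith) (norm_nonneg _))
            fun β hβ => key α hαA β hβ
        have e1 : (2 * ρ) ^ ((card U + 1) * g) = (2 * ρ) ^ g * (2 * ρ) ^ (card U * g) := by
          rw [← pow_add]; congr 1; ring
        rw [e1]
        have hposrow : 0 ≤ (2 * ρ) ^ g * (B.map fun β => ‖α - β‖).prod :=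
          mul_nonneg (pow_nonneg (by linarith) _) (prod_map_nonneg B fun β _ => norm_nonneg _)
        have hposR : 0 ≤ (U.map fun α => 2 * p α).prod ^ g * (B.map fun β => 2 * p β).prod ^ card U :=
          mul_nonneg (pow_nonneg (prod_map_nonneg U fun x _ => by linarith [hp0 x]) _)
            (pow_nonneg (prod_map_nonneg B fun x _ => by linarith [hp0 x]) _)
        calc (2 * ρ) ^ g * (2 * ρ) ^ (card U * g) *
              ((B.map fun β => ‖α - β‖).prod * (U.map fun α => (B.map fun β => ‖α - β‖).prod).prod)
            = ((2 * ρ) ^ g * (B.map fun β => ‖α - β‖).prod) *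
                ((2 * ρ) ^ (card U * g) * (U.map fun α => (B.map fun β => ‖α - β‖).prod).prod) := by
              ring
          _ ≤ ((2 * p α) ^ g * (B.map fun β => 2 * p β).prod) *
                ((U.map fun α => 2 * p α).prod ^ g * (B.map fun β => 2 * p β).prod ^ card U) :=
              mul_le_mul hrow ih' (mul_nonneg (pow_nonneg (by linarith) _) (hP0 U B)) (hposrow.trans hrow)
          _ = (2 * p α * (U.map fun α => 2 * p α).prod) ^ g *
                (B.map fun β => 2 * p β).prod ^ (card U + 1) := by
              rw [mul_pow, pow_succ]; ring
    have := step A fun α h => h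
    rwa [← hf] at this
  -- (3.4): on `A × B'`, `|α - β| ≤ 2 q_β`
  have hb2 : P A B' ≤ (B'.map fun β => 2 * p β).prod ^ f := by
    have key : ∀ α ∈ A, (B'.map fun β => ‖α - β‖).prod ≤ (B'.map fun β => 2 * p β).prod := by
      intro α hα
      refine prod_map_le_prod_map' B' (fun β _ => norm_nonneg _) fun β hβ => ?_
      calc ‖α - β‖ = ‖(θ - β) - (θ - α)‖ := by ring_nf
        _ ≤ ‖θ - β‖ + ‖θ - α‖ := norm_sub_le _ _
        _ ≤ ‖θ - β‖ + ‖θ - β‖ := by linarith [hAB α hα β hβ]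
        _ = 2 * p β := by ring
    calc P A B' ≤ (A.map fun _ => (B'.map fun β => 2 * p β).prod).prod :=
          prod_map_le_prod_map' A (fun α _ => prod_nonneg fun y hy => by
            obtain ⟨β, -, rfl⟩ := mem_map.mp hy; exact norm_nonneg _) key
      _ = _ := by rw [prod_map_const', hf]
  -- (3.4): on `A' × B`, `|α - β| ≤ 2 p_α`
  have hb3 : P A' B ≤ (A'.map fun α => 2 * p α).prod ^ g := by
    have e : P A' B = (B.map fun β => (A'.map fun α => ‖α - β‖).prod).prod := prod_map_prod_map_comm _ _ _
    rw [e]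
    have key : ∀ β ∈ B, (A'.map fun α => ‖α - β‖).prod ≤ (A'.map fun α => 2 * p α).prod := by
      intro β hβ
      refine prod_map_le_prod_map' A' (fun α _ => norm_nonneg _) fun α hα => ?_
      calc ‖α - β‖ = ‖(θ - β) - (θ - α)‖ := by ring_nf
        _ ≤ ‖θ - β‖ + ‖θ - α‖ := norm_sub_le _ _
        _ ≤ ‖θ - α‖ + ‖θ - α‖ := by linarith [hBA β hβ α hα]
        _ = 2 * p α := by ring
    calc (B.map fun β => (A'.map fun α => ‖α - β‖).prod).prod
        ≤ (B.map fun _ => (A'.map fun α => 2 * p α).prod).prod :=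
          prod_map_le_prod_map' B (fun β _ => prod_nonneg fun y hy => by
            obtain ⟨α, -, rfl⟩ := mem_map.mp hy; exact norm_nonneg _) key
      _ = _ := by rw [prod_map_const', hg]
  -- (3.6): on `A' × B'`, `|α - β| ≤ 2 max(1,|α|) max(1,|β|)`
  have hb4 : P A' B' ≤ 2 ^ ((m - f) * (n - g)) * (A'.map fun α => max 1 ‖α‖).prod ^ (n - g) *
      (B'.map fun β => max 1 ‖β‖).prod ^ (m - f) := by
    have key : ∀ α β : ℂ, ‖α - β‖ ≤ 2 * max 1 ‖α‖ * max 1 ‖β‖ := by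
      intro α β
      calc ‖α - β‖ ≤ ‖α‖ + ‖β‖ := norm_sub_le _ _
        _ ≤ max 1 ‖α‖ * max 1 ‖β‖ + max 1 ‖α‖ * max 1 ‖β‖ := by
            gcongr
            · calc ‖α‖ = ‖α‖ * 1 := (mul_one _).symm
                _ ≤ max 1 ‖α‖ * max 1 ‖β‖ :=
                  mul_le_mul (le_max_right _ _) (le_max_left _ _) zero_le_one (by positivity)
            · calc ‖β‖ = 1 * ‖β‖ := (one_mul _).symm
                _ ≤ max 1 ‖α‖ * max 1 ‖β‖ :=
                  mul_le_mul (le_max_left _ _) (le_max_right _ _) (norm_nonneg _) (by positivity)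
        _ = 2 * max 1 ‖α‖ * max 1 ‖β‖ := by ring
    -- `∏_{A' × B'} 2 max(1,|α|) max(1,|β|) = 2^{|A'||B'|} (∏ max(1,|α|))^{|B'|} (∏ max(1,|β|))^{|A'|}`
    have step : ∀ U : Multiset ℂ, P U B' ≤ 2 ^ (card U * card B') *
        (U.map fun α => max 1 ‖α‖).prod ^ card B' * (B'.map fun β => max 1 ‖β‖).prod ^ card U := by
      intro U
      induction U using Multiset.induction_on with
      | empty => simp [hPdef]
      | cons α U ih =>
        simp only [hPdef, map_cons, prod_cons, card_cons] at ih ⊢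
        have hrow : (B'.map fun β => ‖α - β‖).prod ≤
            (2 * max 1 ‖α‖) ^ card B' * (B'.map fun β => max 1 ‖β‖).prod := by
          calc (B'.map fun β => ‖α - β‖).prod ≤ (B'.map fun β => 2 * max 1 ‖α‖ * max 1 ‖β‖).prod :=
                prod_map_le_prod_map' B' (fun β _ => norm_nonneg _) fun β _ => key α β
            _ = _ := by rw [prod_map_mul, prod_map_const']
        calc (B'.map fun β => ‖α - β‖).prod * (U.map fun α => (B'.map fun β => ‖α - β‖).prod).prod
            ≤ ((2 * max 1 ‖α‖) ^ card B' * (B'.map fun β => max 1 ‖β‖).prod) *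
              (2 ^ (card U * card B') * (U.map fun α => max 1 ‖α‖).prod ^ card B' *
                (B'.map fun β => max 1 ‖β‖).prod ^ card U) :=
              mul_le_mul hrow ih (hP0 U B') ((prod_map_nonneg B' fun β _ => norm_nonneg _).trans hrow)
          _ = 2 ^ ((card U + 1) * card B') * (max 1 ‖α‖ * (U.map fun α => max 1 ‖α‖).prod) ^ card B' *
              (B'.map fun β => max 1 ‖β‖).prod ^ (card U + 1) := by
              rw [mul_pow, mul_pow, add_mul, one_mul, pow_add, pow_succ]; ring
    have := step A'
    rwa [hcA', hcB'] at this
  -- Mahler measures and values at `θ`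
  have hMF : F.mahlerMeasure = ‖a‖ * (S.map fun α => max 1 ‖α‖).prod :=
    mahlerMeasure_eq_leadingCoeff_mul_prod_roots F
  have hMG : G.mahlerMeasure = ‖b‖ * (T.map fun β => max 1 ‖β‖).prod :=
    mahlerMeasure_eq_leadingCoeff_mul_prod_roots G
  have hFθ : ‖F.eval θ‖ = ‖a‖ * (S.map p).prod := norm_eval_eq_prod_roots F θ
  have hGθ : ‖G.eval θ‖ = ‖b‖ * (T.map p).prod := norm_eval_eq_prod_roots G θ
  -- `∏_S 2p = ∏_A 2p ∏_{A'} 2p = 2^m ∏_S p`, etc.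
  have hSp : (A.map fun α => 2 * p α).prod * (A'.map fun α => 2 * p α).prod = 2 ^ m * (S.map p).prod := by
    rw [← Multiset.prod_add, ← Multiset.map_add, ← hSA, prod_map_mul, prod_map_const', hSm]
  have hTp : (B.map fun β => 2 * p β).prod * (B'.map fun β => 2 * p β).prod = 2 ^ n * (T.map p).prod := by
    rw [← Multiset.prod_add, ← Multiset.map_add, ← hTB, prod_map_mul, prod_map_const', hTn]
  have hSmax : (A'.map fun α => max 1 ‖α‖).prod ≤ (S.map fun α => max 1 ‖α‖).prod := by
    rw [hSA, Multiset.map_add, Multiset.prod_add]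
    exact le_mul_of_one_le_left (prod_nonneg fun x hx => by
      obtain ⟨α, -, rfl⟩ := mem_map.mp hx; positivity)
      (one_le_prod_map A fun α _ => le_max_left _ _)
  have hTmax : (B'.map fun β => max 1 ‖β‖).prod ≤ (T.map fun β => max 1 ‖β‖).prod := by
    rw [hTB, Multiset.map_add, Multiset.prod_add]
    exact le_mul_of_one_le_left (prod_nonneg fun x hx => by
      obtain ⟨β, -, rfl⟩ := mem_map.mp hx; positivity)
      (one_le_prod_map B fun β _ => le_max_left _ _)
  -- nonnegativity facts
  have hnA : 0 ≤ (A.map fun α => 2 * p α).prod := prod_nonneg fun x hx => by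
    obtain ⟨α, -, rfl⟩ := mem_map.mp hx; positivity
  have hnA' : 0 ≤ (A'.map fun α => 2 * p α).prod := prod_nonneg fun x hx => by
    obtain ⟨α, -, rfl⟩ := mem_map.mp hx; positivity
  have hnB : 0 ≤ (B.map fun β => 2 * p β).prod := prod_nonneg fun x hx => by
    obtain ⟨β, -, rfl⟩ := mem_map.mp hx; positivity
  have hnB' : 0 ≤ (B'.map fun β => 2 * p β).prod := prod_nonneg fun x hx => by
    obtain ⟨β, -, rfl⟩ := mem_map.mp hx; positivity
  have hnmaxA' : 0 ≤ (A'.map fun α => max 1 ‖α‖).prod := prod_nonneg fun x hx => by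
    obtain ⟨α, -, rfl⟩ := mem_map.mp hx; positivity
  have hnmaxB' : 0 ≤ (B'.map fun β => max 1 ‖β‖).prod := prod_nonneg fun x hx => by
    obtain ⟨β, -, rfl⟩ := mem_map.mp hx; positivity
  have hnSp : 0 ≤ (S.map p).prod := prod_nonneg fun x hx => by
    obtain ⟨α, -, rfl⟩ := mem_map.mp hx; exact hp0 α
  have hnTp : 0 ≤ (T.map p).prod := prod_nonneg fun x hx => by
    obtain ⟨β, -, rfl⟩ := mem_map.mp hx; exact hp0 β
  -- assembling: `(2ρ)^{fg} P S T ≤ (∏_S 2p)^g (∏_T 2q)^f 2^{(m-f)(n-g)} (∏_S max)^{n-g} (∏_T max)^{m-f}`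
  have hb4' : P A' B' ≤ 2 ^ ((m - f) * (n - g)) * (S.map fun α => max 1 ‖α‖).prod ^ (n - g) *
      (T.map fun β => max 1 ‖β‖).prod ^ (m - f) := by
    refine hb4.trans ?_
    refine mul_le_mul (mul_le_mul_of_nonneg_left (pow_le_pow_left₀ hnmaxA' hSmax _) (by positivity))
      (pow_le_pow_left₀ hnmaxB' hTmax _) (pow_nonneg hnmaxB' _) ?_
    exact mul_nonneg (by positivity) (pow_nonneg (hnmaxA'.trans hSmax) _)
  have hmain : (2 * ρ) ^ (f * g) * P S T ≤
      (2 ^ m * (S.map p).prod) ^ g * (2 ^ n * (T.map p).prod) ^ f *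
        (2 ^ ((m - f) * (n - g)) * (S.map fun α => max 1 ‖α‖).prod ^ (n - g) *
          (T.map fun β => max 1 ‖β‖).prod ^ (m - f)) := by
    have h12 : (2 * ρ) ^ (f * g) * P A B * P A B' ≤
        ((A.map fun α => 2 * p α).prod ^ g * (B.map fun β => 2 * p β).prod ^ f) *
          (B'.map fun β => 2 * p β).prod ^ f :=
      mul_le_mul hb1 hb2 (hP0 _ _) (by positivity)
    have h34 : P A' B * P A' B' ≤ (A'.map fun α => 2 * p α).prod ^ g *
        (2 ^ ((m - f) * (n - g)) * (S.map fun α => max 1 ‖α‖).prod ^ (n - g) *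
          (T.map fun β => max 1 ‖β‖).prod ^ (m - f)) :=
      mul_le_mul hb3 hb4' (hP0 _ _) (by positivity)
    calc (2 * ρ) ^ (f * g) * P S T = ((2 * ρ) ^ (f * g) * P A B * P A B') * (P A' B * P A' B') := by
          rw [hPsplit]; ring
      _ ≤ (((A.map fun α => 2 * p α).prod ^ g * (B.map fun β => 2 * p β).prod ^ f) *
            (B'.map fun β => 2 * p β).prod ^ f) *
          ((A'.map fun α => 2 * p α).prod ^ g *
            (2 ^ ((m - f) * (n - g)) * (S.map fun α => max 1 ‖α‖).prod ^ (n - g) *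
              (T.map fun β => max 1 ‖β‖).prod ^ (m - f))) :=
          mul_le_mul h12 h34 (mul_nonneg (hP0 _ _) (hP0 _ _)) (by positivity)
      _ = ((A.map fun α => 2 * p α).prod * (A'.map fun α => 2 * p α).prod) ^ g *
            ((B.map fun β => 2 * p β).prod * (B'.map fun β => 2 * p β).prod) ^ f *
          (2 ^ ((m - f) * (n - g)) * (S.map fun α => max 1 ‖α‖).prod ^ (n - g) *
              (T.map fun β => max 1 ‖β‖).prod ^ (m - f)) := by
          rw [mul_pow, mul_pow]; ring
      _ = _ := by rw [hSp, hTp]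
  -- conclude, multiplying by `|a|^n |b|^m` and dividing by `2^{fg}`
  have hres' : resultant F G = resultant F G m n := rfl
  rw [hres', hnormres]
  have h2 : (0 : ℝ) < 2 ^ (f * g) := by positivity
  rw [← mul_le_mul_iff_of_pos_left h2]
  have han : ‖a‖ ^ n = ‖a‖ ^ g * ‖a‖ ^ (n - g) := by rw [← pow_add]; congr 1; omega
  have hbm : ‖b‖ ^ m = ‖b‖ ^ f * ‖b‖ ^ (m - f) := by rw [← pow_add]; congr 1; omega
  have hpow2 : (2 : ℝ) ^ (f * g) * 2 ^ (m * n) = (2 ^ m) ^ g * (2 ^ n) ^ f * 2 ^ ((m - f) * (n - g)) := by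
    rw [← pow_mul, ← pow_mul, ← pow_add, ← pow_add, ← pow_add]
    congr 1
    zify [hfm, hgn]
    ring
  calc 2 ^ (f * g) * (ρ ^ (f * g) * (‖a‖ ^ n * ‖b‖ ^ m * P S T))
      = ‖a‖ ^ n * ‖b‖ ^ m * ((2 * ρ) ^ (f * g) * P S T) := by rw [mul_pow]; ring
    _ ≤ ‖a‖ ^ n * ‖b‖ ^ m * ((2 ^ m * (S.map p).prod) ^ g * (2 ^ n * (T.map p).prod) ^ f *
        (2 ^ ((m - f) * (n - g)) * (S.map fun α => max 1 ‖α‖).prod ^ (n - g) *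
          (T.map fun β => max 1 ‖β‖).prod ^ (m - f))) :=
        mul_le_mul_of_nonneg_left hmain (by positivity)
    _ = ((2 : ℝ) ^ (f * g) * 2 ^ (m * n)) * (‖a‖ ^ (n - g) * (S.map fun α => max 1 ‖α‖).prod ^ (n - g)) *
        (‖b‖ ^ (m - f) * (T.map fun β => max 1 ‖β‖).prod ^ (m - f)) *
        (‖a‖ ^ g * (S.map p).prod ^ g) * (‖b‖ ^ f * (T.map p).prod ^ f) := by
        rw [hpow2, han, hbm, mul_pow, mul_pow]; ring
    _ = 2 ^ (f * g) * (2 ^ (m * n) * F.mahlerMeasure ^ (n - g) * G.mahlerMeasure ^ (m - f) *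
        ‖F.eval θ‖ ^ g * ‖G.eval θ‖ ^ f) := by
        rw [hMF, hMG, hFθ, hGθ, mul_pow, mul_pow, mul_pow, mul_pow]; ring

/-- **Roy–Waldschmidt 1997, Lemme 3.4, as printed (threshold form).**  With `f`, `g` the numbers
of roots of `F`, `G` (with multiplicity) at distance `≤ t` from `θ` and `0 ≤ ρ` a lower bound for the
distance from `θ` to all the roots (e.g. that distance itself),
`ρ^{fg} |Res(F,G)| ≤ 2^{mn} M(F)^{n-g} M(G)^{m-f} |F(θ)|^g |G(θ)|^f`.
[cite: RoyWaldschmidt1997ENS, §3 (ii) Lemme 3.4 (3.3), p. 765] -/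
theorem resultant_wirsing_threshold (F G : ℂ[X]) (hF : F ≠ 0) (hG : G ≠ 0) (θ : ℂ) (t ρ : ℝ)
    (hρ : 0 ≤ ρ) (hρF : ∀ α ∈ F.roots, ρ ≤ ‖θ - α‖) (hρG : ∀ β ∈ G.roots, ρ ≤ ‖θ - β‖) :
    ρ ^ (card (F.roots.filter fun α => ‖θ - α‖ ≤ t) * card (G.roots.filter fun β => ‖θ - β‖ ≤ t)) *
        ‖resultant F G‖ ≤
      2 ^ (F.natDegree * G.natDegree) *
        F.mahlerMeasure ^ (G.natDegree - card (G.roots.filter fun β => ‖θ - β‖ ≤ t)) *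
        G.mahlerMeasure ^ (F.natDegree - card (F.roots.filter fun α => ‖θ - α‖ ≤ t)) *
        ‖F.eval θ‖ ^ card (G.roots.filter fun β => ‖θ - β‖ ≤ t) *
        ‖G.eval θ‖ ^ card (F.roots.filter fun α => ‖θ - α‖ ≤ t) := by
  classical
  have hcF : F.roots - F.roots.filter (fun α => ‖θ - α‖ ≤ t) = F.roots.filter (fun α => ¬ ‖θ - α‖ ≤ t) := by
    nth_rw 1 [← Multiset.filter_add_not (fun α => ‖θ - α‖ ≤ t) F.roots]
    rw [add_tsub_cancel_left]
  have hcG : G.roots - G.roots.filter (fun β => ‖θ - β‖ ≤ t) = G.roots.filter (fun β => ¬ ‖θ - β‖ ≤ t) := by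
    nth_rw 1 [← Multiset.filter_add_not (fun β => ‖θ - β‖ ≤ t) G.roots]
    rw [add_tsub_cancel_left]
  refine resultant_wirsing F G hF hG θ _ _ (Multiset.filter_le _ _) (Multiset.filter_le _ _) ρ hρ hρF hρG
    ?_ ?_
  · intro α hα β hβ
    rw [hcG] at hβ
    have h1 := (Multiset.mem_filter.mp hα).2
    have h2 := (Multiset.mem_filter.mp hβ).2
    linarith [not_le.mp h2]
  · intro β hβ α hα
    rw [hcF] at hα
    have h1 := (Multiset.mem_filter.mp hβ).2
    have h2 := (Multiset.mem_filter.mp hα).2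
    linarith [not_le.mp h2]

end RoyWaldschmidt1997

end Literature.NumberTheory.Transcendental
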